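import Literature.AlgebraicGeometry.Frobenioids.PerfFactorialSupports
import Literature.AlgebraicGeometry.Frobenioids.PrimesEquivalence
import Literature.AlgebraicGeometry.Frobenioids.PerfectionDivisorial
import Literature.AlgebraicGeometry.Frobenioids.Thm42PrimaryStepsPropagation
import HarnessLib

/-!
# Perf-factorial monoids: an order-isomorphism that is multiplicative on each prime ray is multiplicative

Mochizuki, *The geometry of Frobenioids I: the general theory*, Kyushu J. Math. **62** (2008)
293–400, §2 Def. 2.4 (i) (perf-factorial monoids, kurims p. 47–48) and §4, proof of Theorem 4.9, p. 89
ll. 6–36 [cite: MochizukiFrdI2008, Thm. 4.9 p.89]: "`Ψ^Prime` extends … to an isomorphism of monoids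
`Φ₁(A₁)^pf_𝔭₁ ≅ Φ₂(A₂)^pf_𝔭₂` … Thus … we obtain isomorphisms of monoids `Φ₁(A₁)^pf_factor ≅
Φ₂(A₂)^pf_factor` … [and] an isomorphism of monoids `Φ₁(A₁) ≅ Φ₂(A₂)`" — the ASSEMBLY of monoid
isomorphisms on the prime rays into a monoid isomorphism, in the following order-theoretic form (PROOF
ONLY, no new definitions): for PERFECT perf-factorial monoids `M`, `N` and a bijection `f : M → N` with
`x ≤ y ↔ f x ≤ f y` which is multiplicative on each prime ray (`x, y` primary of the same prime), `f` is a
homomorphism of monoids (`IsPerfFactorial.map_mul_of_dvd_iff_of_rays`). Ingredients (Def. 2.4 (i)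
(b)(c)(d), "the primary factorizations"): the `𝔮`-component / `𝔮`-free splitting of an element
(`IsPerfFactorial.exists_split`, seat abc-iut-L1-t14), divisibility detected by primary divisors
(`dvd_of_forall_isPrimary_dvd`), products of ray-coprime elements as least common multiples, and the
order-theoretic description of primary elements (`IsPerfFactorial.isPrimary_iff_dvd_total`). Consumer: the
divisor-monoid transport `Φ₁(A) → Φ₂(ΨA)`, `Div φ ↦ Div Ψφ` of [FrdI] Thm. 4.9 (an order isomorphism by
Def. 1.3 (iii)(d); multiplicative on rays by Thm. 4.2 (iii)). Nothing here bears on [IUTchIII].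
-/

namespace Literature.AlgebraicGeometry.Frobenioids

open Function

universe u

variable {M : Type u} [CommMonoid M]

/-! ### 1. Components in `M^pf` (Def. 2.4 (i)(c)(d)) -/

namespace IsPerfFactorial

/-- An element of the ray `M^pf_𝔮 = 𝔮 ∪ {0}` has trivial coordinates off `𝔮`.
[cite: MochizukiFrdI2008, Def. 2.4 (i) p.47] -/
theorem factorMap_apply_eq_one_of_mem_submonoid (h : IsPerfFactorial M) {𝔮 𝔮' : Primes (Perfection M)}
    {a : Perfection M} (ha : a ∈ 𝔮.submonoid) (hne : 𝔮' ≠ 𝔮) : factorMap M a 𝔮' = 1 := by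
  rcases (𝔮.mem_submonoid_iff' a).mp ha with rfl | hac
  · rw [h.factorMap_one]; rfl
  · exact factorMap_apply_of_ne M hac hne

/-- **Maximality of the `𝔮`-component**: if `z ∈ 𝔮` divides `a₁ · a₂` with `a₁ ∈ M^pf_𝔮` and `a₂`
`𝔮`-free, then `z` divides `a₁` ("by comparing the primary factorizations", Def. 2.4 (i)(c)(d)).
[cite: MochizukiFrdI2008, Def. 2.4 (i) p.47] -/
theorem dvd_of_mem_carrier_of_dvd_mul (h : IsPerfFactorial M) {𝔮 : Primes (Perfection M)}
    {z a₁ a₂ : Perfection M} (hz : z ∈ 𝔮.carrier) (ha₁ : a₁ ∈ 𝔮.submonoid)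
    (ha₂ : factorMap M a₂ 𝔮 = 1) (hd : z ∣ a₁ * a₂) : z ∣ a₁ := by
  classical
  obtain ⟨w, hw⟩ := hd
  obtain ⟨xw, hxw⟩ := h.factorMap_mem_range w
  refine h.dvd_of_factorMap_mul_eq (x := Pi.mulSingle 𝔮 (xw 𝔮)) ?_
  funext 𝔮'
  have hco := congrFun (show factorMap M a₁ * factorMap M a₂ = factorMap M z * factorMap M w by
    rw [← h.factorMap_mul, ← h.factorMap_mul, hw]) 𝔮'
  rw [Pi.mul_apply, Pi.mul_apply] at hco
  rw [Pi.mul_apply, pfFactorToRlfFactor_apply]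
  by_cases e : 𝔮' = 𝔮
  · subst e
    rw [ha₂, mul_one] at hco
    rw [Pi.mulSingle_eq_same, hco, ← hxw, pfFactorToRlfFactor_apply]
  · rw [Pi.mulSingle_eq_of_ne e, map_one, mul_one, factorMap_apply_of_ne M hz e,
      h.factorMap_apply_eq_one_of_mem_submonoid ha₁ e]

/-- An element with no divisor in `𝔮` is `𝔮`-free (zero `𝔮`-coordinate).
[cite: MochizukiFrdI2008, Def. 2.4 (i) p.47] -/
theorem factorMap_apply_eq_one_of_forall_not_dvd (h : IsPerfFactorial M) {𝔮 : Primes (Perfection M)}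
    {t : Perfection M} (ht : ∀ z ∈ 𝔮.carrier, ¬ z ∣ t) : factorMap M t 𝔮 = 1 := by
  obtain ⟨t₁, t₂, xt, hts, ht₁, ht₂⟩ := h.exists_split t 𝔮
  by_cases h1 : t₁ = 1
  · rw [h1, one_mul] at hts
    rw [← hts]; exact ht₂
  · exact absurd ⟨t₂, hts.symm⟩ (ht t₁ (h.mem_carrier_of_factorMap_eq_mulSingle xt ht₁ h1))

/-- A non-trivial divisor of a ray element `a ∈ M^pf_𝔮` lies in `𝔮`. [cite: MochizukiFrdI2008, §0 p.12] -/
theorem mem_carrier_of_dvd_of_mem_submonoid (hM : IsSharp M) {𝔮 : Primes (Perfection M)}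
    {z a : Perfection M} (hz : z ≠ 1) (ha : a ∈ 𝔮.submonoid) (hza : z ∣ a) : z ∈ 𝔮.carrier := by
  rcases (𝔮.mem_submonoid_iff' a).mp ha with rfl | hac
  · exact absurd ((Perfection.isSharp hM).1 z (isUnit_of_dvd_one hza)) hz
  · exact 𝔮.mem_carrier_of_precsim hac hz (Precsim.of_dvd hza)

/-- **Divisibility is detected by primary divisors** (Def. 2.4 (i)(c)(d): `a ≤ b` iff it holds
coordinatewise in `M^pf_factor`, and each coordinate is read off the primary divisors): if every primary
divisor of `u` divides `v`, then `u ∣ v`. [cite: MochizukiFrdI2008, Def. 2.4 (i) p.47] -/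
theorem dvd_of_forall_isPrimary_dvd (h : IsPerfFactorial M) {u v : Perfection M}
    (H : ∀ p : Perfection M, IsPrimary p → p ∣ u → p ∣ v) : u ∣ v := by
  classical
  -- split `u` and `v` at every prime
  choose u₁ u₂ xu hus hu₁ hu₂ using fun 𝔮 => h.exists_split u 𝔮
  choose v₁ v₂ xv hvs hv₁ hv₂ using fun 𝔮 => h.exists_split v 𝔮
  -- at each prime the `𝔮`-component of `u` divides that of `v`
  have hdiv : ∀ 𝔮, u₁ 𝔮 ∣ v₁ 𝔮 := by
    intro 𝔮
    by_cases h1 : u₁ 𝔮 = 1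
    · rw [h1]; exact one_dvd _
    have hc : u₁ 𝔮 ∈ 𝔮.carrier := h.mem_carrier_of_factorMap_eq_mulSingle (xu 𝔮) (hu₁ 𝔮) h1
    have hdu : u₁ 𝔮 ∣ u := ⟨u₂ 𝔮, (hus 𝔮).symm⟩
    have hdv : u₁ 𝔮 ∣ v := H _ hc.1 hdu
    rw [← hvs 𝔮] at hdv
    have hv₁m : v₁ 𝔮 ∈ 𝔮.submonoid := by
      by_cases e : v₁ 𝔮 = 1
      · rw [e]; exact one_mem _
      · exact Submonoid.subset_closure (h.mem_carrier_of_factorMap_eq_mulSingle (xv 𝔮) (hv₁ 𝔮) e)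
    exact h.dvd_of_mem_carrier_of_dvd_mul hc hv₁m (hv₂ 𝔮) hdv
  choose c hc using hdiv
  choose xc hxc using fun 𝔮 => h.factorMap_mem_range (c 𝔮)
  refine h.dvd_of_factorMap_mul_eq (x := fun 𝔮 => xc 𝔮 𝔮) ?_
  funext 𝔮
  rw [Pi.mul_apply, pfFactorToRlfFactor_apply, h.factorMap_apply_of_split_same (hus 𝔮) (hu₂ 𝔮),
    h.factorMap_apply_of_split_same (hvs 𝔮) (hv₂ 𝔮), hc 𝔮, h.factorMap_mul, Pi.mul_apply, ← hxc 𝔮,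
    pfFactorToRlfFactor_apply]

/-! ### 2. Rays `𝔭 ∪ {0}` in a perfect perf-factorial monoid, through a representative `p ∈ 𝔭` -/

/-- For primaries, `x ≼ y` (same prime) iff `x`, `y` are comparable for `≤` (Def. 2.4 (i)(b): `M_𝔭` is
monoprime). [cite: MochizukiFrdI2008, Def. 2.4 (i) p.47] -/
theorem precsim_iff_dvd_or_dvd_of_isPrimary (h : IsPerfFactorial M) {x y : M} (hx : IsPrimary x)
    (hy : IsPrimary y) : x ≼ y ↔ (x ∣ y ∨ y ∣ x) := by
  constructor
  · intro hxy
    let 𝔭 : Primes M := Quotient.mk (primarySetoid M) ⟨y, hy⟩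
    have hyp : y ∈ 𝔭.carrier := mem_carrier_mk_of_isPrimary hy
    have hxp : x ∈ 𝔭.carrier := 𝔭.mem_carrier_of_precsim hyp hx.1 hxy
    exact h.dvd_total_of_mem_submonoid 𝔭 (Submonoid.subset_closure hxp) (Submonoid.subset_closure hyp)
  · rintro (hd | hd)
    · exact Precsim.of_dvd hd
    · exact hx.2 y hy.1 (Precsim.of_dvd hd)

/-- A product of two elements of the ray of `p` lies in the ray of `p`. [cite: MochizukiFrdI2008, §0 p.12] -/
theorem ray_mul (h : IsPerfFactorial M) {p a b : M} (hp : IsPrimary p)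
    (ha : a = 1 ∨ (IsPrimary a ∧ a ≼ p)) (hb : b = 1 ∨ (IsPrimary b ∧ b ≼ p)) :
    a * b = 1 ∨ (IsPrimary (a * b) ∧ a * b ≼ p) := by
  have hM : IsSharp M := h.isDivisorial.isSharp
  rcases ha with rfl | ⟨ha, hap⟩
  · rw [one_mul]; exact hb
  rcases hb with rfl | ⟨hb, hbp⟩
  · rw [mul_one]; exact Or.inr ⟨ha, hap⟩
  right
  obtain ⟨n, hn, hdn⟩ := hap
  obtain ⟨m, -, hdm⟩ := hbp
  have hprec : a * b ≼ p := ⟨n + m, Nat.add_pos_left hn m, by rw [pow_add]; exact mul_dvd_mul hdn hdm⟩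
  have hne : a * b ≠ 1 := fun e => ha.1 (hM.1 a (IsUnit.of_mul_eq_one b e))
  exact ⟨hp.of_precsim hprec hne, hprec⟩

/-- A non-trivial divisor of an element of the ray of `p` lies in the ray of `p`. [cite: MochizukiFrdI2008, §0 p.12] -/
theorem ray_of_dvd (h : IsPerfFactorial M) {p a z : M} (hz : z ≠ 1)
    (ha : a = 1 ∨ (IsPrimary a ∧ a ≼ p)) (hza : z ∣ a) : IsPrimary z ∧ z ≼ p := by
  have hM : IsSharp M := h.isDivisorial.isSharp
  rcases ha with rfl | ⟨ha, hap⟩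
  · exact absurd (hM.1 z (isUnit_of_dvd_one hza)) hz
  · exact ⟨ha.of_precsim (Precsim.of_dvd hza) hz, (Precsim.of_dvd hza).trans hap⟩

/-- **The `𝔭`-component / `𝔭`-free splitting at the level of `M`** (perfect `M`; Def. 2.4 (i)(c)(d)):
`x = x₁ · x₂` with `x₁` in the ray of `p` and `x₂` without divisors in the ray of `p`.
[cite: MochizukiFrdI2008, Def. 2.4 (i) p.47] -/
theorem exists_raySplit (h : IsPerfFactorial M) (hperf : IsPerfect M) (x : M) {p : M} (hp : IsPrimary p) :
    ∃ x₁ x₂ : M, x₁ * x₂ = x ∧ (x₁ = 1 ∨ (IsPrimary x₁ ∧ x₁ ≼ p)) ∧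
      ∀ z : M, IsPrimary z → z ≼ p → ¬ z ∣ x₂ := by
  have hM : IsSharp M := h.isDivisorial.isSharp
  have hbij := isPerfect_iff_bijective_of.mp hperf
  have hop : IsPrimary (Perfection.of M p) := (Perfection.isPrimary_of_iff hM).mpr hp
  let 𝔮 : Primes (Perfection M) := Quotient.mk _ ⟨_, hop⟩
  have hp𝔮 : Perfection.of M p ∈ 𝔮.carrier := mem_carrier_mk_of_isPrimary hop
  obtain ⟨ξ₁, ξ₂, xx, hξs, hξ₁, hξ₂⟩ := h.exists_split (Perfection.of M x) 𝔮
  obtain ⟨X₁, hX₁⟩ := hbij.2 ξ₁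
  obtain ⟨X₂, hX₂⟩ := hbij.2 ξ₂
  refine ⟨X₁, X₂, hbij.1 (by rw [map_mul, hX₁, hX₂, hξs]), ?_, fun z hz hzp hd => ?_⟩
  · by_cases h1 : ξ₁ = 1
    · left; exact hbij.1 (by rw [hX₁, h1, map_one])
    · right
      have hc : ξ₁ ∈ 𝔮.carrier := h.mem_carrier_of_factorMap_eq_mulSingle xx hξ₁ h1
      refine ⟨(Perfection.isPrimary_of_iff hM).mp (hX₁ ▸ hc.1), ?_⟩
      exact Perfection.of_precsim_of_iff.mp (hX₁ ▸ 𝔮.precsim_of_mem_carrier hc hp𝔮)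
  · have hzc : Perfection.of M z ∈ 𝔮.carrier := 𝔮.mem_carrier_of_precsim hp𝔮
      (fun e => hz.1 (hbij.1 (by rw [e, map_one]))) (Precsim.map _ hzp)
    exact h.not_dvd_of_factorMap_apply_eq_one hzc hξ₂ (hX₂ ▸ map_dvd (Perfection.of M) hd)

/-- **Maximality of the `𝔭`-component at the level of `M`** (perfect `M`): a primary `z` of the ray of
`p` dividing `a · t`, with `a` in the ray and `t` without divisors in the ray, divides `a`.
[cite: MochizukiFrdI2008, Def. 2.4 (i) p.47] -/
theorem dvd_of_ray_of_dvd_mul (h : IsPerfFactorial M) (hperf : IsPerfect M) {p z a t : M}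
    (hp : IsPrimary p) (hz : IsPrimary z) (hzp : z ≼ p) (ha : a = 1 ∨ (IsPrimary a ∧ a ≼ p))
    (ht : ∀ z' : M, IsPrimary z' → z' ≼ p → ¬ z' ∣ t) (hd : z ∣ a * t) : z ∣ a := by
  have hM : IsSharp M := h.isDivisorial.isSharp
  have hbij := isPerfect_iff_bijective_of.mp hperf
  have hop : IsPrimary (Perfection.of M p) := (Perfection.isPrimary_of_iff hM).mpr hp
  let 𝔮 : Primes (Perfection M) := Quotient.mk _ ⟨_, hop⟩
  have hp𝔮 : Perfection.of M p ∈ 𝔮.carrier := mem_carrier_mk_of_isPrimary hop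
  have hmem : ∀ {w : M}, IsPrimary w → w ≼ p → Perfection.of M w ∈ 𝔮.carrier := fun hw hwp =>
    𝔮.mem_carrier_of_precsim hp𝔮 (fun e => hw.1 (hbij.1 (by rw [e, map_one]))) (Precsim.map _ hwp)
  have ha' : Perfection.of M a ∈ 𝔮.submonoid := by
    rcases ha with rfl | ⟨ha, hap⟩
    · rw [map_one]; exact one_mem _
    · exact Submonoid.subset_closure (hmem ha hap)
  have ht' : factorMap M (Perfection.of M t) 𝔮 = 1 := by
    refine h.factorMap_apply_eq_one_of_forall_not_dvd fun ζ hζ hζt => ?_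
    obtain ⟨Z, rfl⟩ := hbij.2 ζ
    have hZ : IsPrimary Z := (Perfection.isPrimary_of_iff hM).mp hζ.1
    have hZp : Z ≼ p := Perfection.of_precsim_of_iff.mp (𝔮.precsim_of_mem_carrier hζ hp𝔮)
    exact ht Z hZ hZp ((Perfection.of_dvd_of_iff hbij).mp hζt)
  exact (Perfection.of_dvd_of_iff hbij).mp
    (h.dvd_of_mem_carrier_of_dvd_mul (hmem hz hzp) ha' ht' (by rw [← map_mul]; exact map_dvd _ hd))

/-- Elements without divisors in the ray of `p` are closed under products (their `𝔭`-coordinates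
vanish). [cite: MochizukiFrdI2008, Def. 2.4 (i) p.47] -/
theorem rayFree_mul (h : IsPerfFactorial M) (hperf : IsPerfect M) {p t t' : M} (hp : IsPrimary p)
    (ht : ∀ z : M, IsPrimary z → z ≼ p → ¬ z ∣ t) (ht' : ∀ z : M, IsPrimary z → z ≼ p → ¬ z ∣ t') :
    ∀ z : M, IsPrimary z → z ≼ p → ¬ z ∣ t * t' := by
  have hM : IsSharp M := h.isDivisorial.isSharp
  have hbij := isPerfect_iff_bijective_of.mp hperf
  have hop : IsPrimary (Perfection.of M p) := (Perfection.isPrimary_of_iff hM).mpr hp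
  let 𝔮 : Primes (Perfection M) := Quotient.mk _ ⟨_, hop⟩
  have hp𝔮 : Perfection.of M p ∈ 𝔮.carrier := mem_carrier_mk_of_isPrimary hop
  have free : ∀ {s : M}, (∀ z : M, IsPrimary z → z ≼ p → ¬ z ∣ s) →
      factorMap M (Perfection.of M s) 𝔮 = 1 := by
    intro s hs
    refine h.factorMap_apply_eq_one_of_forall_not_dvd fun ζ hζ hζt => ?_
    obtain ⟨Z, rfl⟩ := hbij.2 ζ
    exact hs Z ((Perfection.isPrimary_of_iff hM).mp hζ.1)
      (Perfection.of_precsim_of_iff.mp (𝔮.precsim_of_mem_carrier hζ hp𝔮))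
      ((Perfection.of_dvd_of_iff hbij).mp hζt)
  intro z hz hzp hd
  have hzc : Perfection.of M z ∈ 𝔮.carrier := 𝔮.mem_carrier_of_precsim hp𝔮
    (fun e => hz.1 (hbij.1 (by rw [e, map_one]))) (Precsim.map _ hzp)
  refine h.not_dvd_of_factorMap_apply_eq_one hzc (y₂ := Perfection.of M (t * t')) ?_ (map_dvd _ hd)
  rw [map_mul, h.factorMap_mul, Pi.mul_apply, free ht, free ht', mul_one]

/-- Divisibility is detected by primary divisors, at the level of a perfect `M`.
[cite: MochizukiFrdI2008, Def. 2.4 (i) p.47] -/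
theorem dvd_of_forall_isPrimary_dvd' (h : IsPerfFactorial M) (hperf : IsPerfect M) {u v : M}
    (H : ∀ p : M, IsPrimary p → p ∣ u → p ∣ v) : u ∣ v := by
  have hM : IsSharp M := h.isDivisorial.isSharp
  have hbij := isPerfect_iff_bijective_of.mp hperf
  refine (Perfection.of_dvd_of_iff hbij).mp (h.dvd_of_forall_isPrimary_dvd fun P hP hPu => ?_)
  obtain ⟨p, rfl⟩ := hbij.2 P
  exact (Perfection.of_dvd_of_iff hbij).mpr
    (H p ((Perfection.isPrimary_of_iff hM).mp hP) ((Perfection.of_dvd_of_iff hbij).mp hPu))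

end IsPerfFactorial

/-! ### 3. Order-isomorphisms multiplicative on rays are multiplicative -/

section OrderIso

universe u'

variable {N : Type u'} [CommMonoid N]

/-- A bijection with `x ≤ y ↔ f x ≤ f y` onto a sharp monoid maps `0` to `0` (`0` is the least element
for `≤`, and the units of a sharp monoid are trivial, §0 p. 12). [cite: MochizukiFrdI2008, §0 p.12] -/
theorem map_one_of_dvd_iff (hN : IsSharp N) (f : M → N) (hf : Surjective f)
    (hdvd : ∀ x y : M, x ∣ y ↔ f x ∣ f y) : f 1 = 1 := by
  obtain ⟨y, hy⟩ := hf 1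
  exact hN.1 _ (isUnit_of_dvd_one (hy ▸ (hdvd 1 y).mp (one_dvd y)))

variable (hM : IsPerfFactorial M) (hN : IsPerfFactorial N) (hMp : IsPerfect M) (hNp : IsPerfect N)
  (f : M → N) (hf : Bijective f) (hdvd : ∀ x y : M, x ∣ y ↔ f x ∣ f y)
include hM hN hMp hNp hf hdvd

/-- An order-isomorphism between perfect perf-factorial monoids preserves and reflects primary
elements (primary = non-zero with totally ordered divisors, `IsPerfFactorial.isPrimary_iff_dvd_total`).
[cite: MochizukiFrdI2008, Def. 2.4 (i) p.47] -/
theorem isPrimary_map_iff_of_dvd_iff (x : M) : IsPrimary (f x) ↔ IsPrimary x := by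
  have h1 : f 1 = 1 := map_one_of_dvd_iff hN.isDivisorial.isSharp f hf.2 hdvd
  rw [hM.isPrimary_iff_dvd_total hMp, hN.isPrimary_iff_dvd_total hNp]
  constructor
  · rintro ⟨hne, htot⟩
    refine ⟨fun e => hne (by rw [e, h1]), fun b c hb hc => ?_⟩
    rcases htot (f b) (f c) ((hdvd _ _).mp hb) ((hdvd _ _).mp hc) with hbc | hcb
    · exact Or.inl ((hdvd _ _).mpr hbc)
    · exact Or.inr ((hdvd _ _).mpr hcb)
  · rintro ⟨hne, htot⟩
    refine ⟨fun e => hne (hf.1 (by rw [e, h1])), fun b' c' hb' hc' => ?_⟩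
    obtain ⟨b, rfl⟩ := hf.2 b'
    obtain ⟨c, rfl⟩ := hf.2 c'
    rcases htot b c ((hdvd _ _).mpr hb') ((hdvd _ _).mpr hc') with hbc | hcb
    · exact Or.inl ((hdvd _ _).mp hbc)
    · exact Or.inr ((hdvd _ _).mp hcb)

/-- Such an `f` preserves and reflects "same prime" among primaries. [cite: MochizukiFrdI2008, Def. 2.4 (i) p.47] -/
theorem precsim_map_iff_of_dvd_iff {x y : M} (hx : IsPrimary x) (hy : IsPrimary y) :
    f x ≼ f y ↔ x ≼ y := by
  have hfx := (isPrimary_map_iff_of_dvd_iff hM hN hMp hNp f hf hdvd x).mpr hx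
  have hfy := (isPrimary_map_iff_of_dvd_iff hM hN hMp hNp f hf hdvd y).mpr hy
  rw [hN.precsim_iff_dvd_or_dvd_of_isPrimary hfx hfy, hM.precsim_iff_dvd_or_dvd_of_isPrimary hx hy,
    ← hdvd, ← hdvd]

/-- Such an `f` is multiplicative on ray-coprime pairs: for `a`, `b` without common non-trivial divisor,
`a · b` is the least common multiple of `a`, `b` (Def. 2.4 (i)(c)(d)), which `f` transports.
[cite: MochizukiFrdI2008, Def. 2.4 (i) p.47] -/
theorem map_mul_of_forall_common_dvd_eq_one {a b : M} (hco : ∀ z : M, z ∣ a → z ∣ b → z = 1) :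
    f (a * b) = f a * f b := by
  have h1 : f 1 = 1 := map_one_of_dvd_iff hN.isDivisorial.isSharp f hf.2 hdvd
  haveI : IsCancelMul N := isIntegral_iff_isCancelMul.mp hN.isDivisorial.isPreDivisorial.isIntegral
  have hco' : ∀ z : N, z ∣ f a → z ∣ f b → z = 1 := by
    intro z hza hzb
    obtain ⟨w, rfl⟩ := hf.2 z
    rw [hco w ((hdvd _ _).mpr hza) ((hdvd _ _).mpr hzb), h1]
  refine dvd_antisymm_of_isSharp hN.isDivisorial.isSharp ?_ ?_
  · obtain ⟨c, hc⟩ := hf.2 (f a * f b)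
    have hac : a ∣ c := (hdvd _ _).mpr (hc ▸ Dvd.intro _ rfl)
    have hbc : b ∣ c := (hdvd _ _).mpr (hc ▸ Dvd.intro_left _ rfl)
    rw [← hc]
    exact (hdvd _ _).mp (hM.mul_dvd_of_forall_common_dvd_eq_one hMp hco hac hbc)
  · exact hN.mul_dvd_of_forall_common_dvd_eq_one hNp hco' ((hdvd _ _).mp (Dvd.intro _ rfl))
      ((hdvd _ _).mp (Dvd.intro_left _ rfl))

/-- **An order-isomorphism of perfect perf-factorial monoids that is multiplicative on each prime ray is a
homomorphism of monoids** (the assembly step of the proof of [FrdI] Thm. 4.9, p. 89 ll. 6–36, in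
order-theoretic form). [cite: MochizukiFrdI2008, Thm. 4.9 p.89] -/
theorem IsPerfFactorial.map_mul_of_dvd_iff_of_rays
    (hray : ∀ x y : M, IsPrimary x → IsPrimary y → x ≼ y → f (x * y) = f x * f y) (x y : M) :
    f (x * y) = f x * f y := by
  have hMs : IsSharp M := hM.isDivisorial.isSharp
  have hNs : IsSharp N := hN.isDivisorial.isSharp
  haveI : IsCancelMul N := isIntegral_iff_isCancelMul.mp hN.isDivisorial.isPreDivisorial.isIntegral
  have h1 : f 1 = 1 := map_one_of_dvd_iff hNs f hf.2 hdvd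
  have hprim := isPrimary_map_iff_of_dvd_iff hM hN hMp hNp f hf hdvd
  have hprec := fun {x y : M} (hx : IsPrimary x) (hy : IsPrimary y) =>
    precsim_map_iff_of_dvd_iff hM hN hMp hNp f hf hdvd hx hy
  -- multiplicativity on the whole ray of `p` (including `1`)
  have hray' : ∀ {p a b : M}, IsPrimary p → (a = 1 ∨ (IsPrimary a ∧ a ≼ p)) →
      (b = 1 ∨ (IsPrimary b ∧ b ≼ p)) → f (a * b) = f a * f b := by
    intro p a b hp ha hb
    rcases ha with rfl | ⟨ha, hap⟩
    · rw [one_mul, h1, one_mul]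
    rcases hb with rfl | ⟨hb, hbp⟩
    · rw [mul_one, h1, mul_one]
    exact hray a b ha hb (hap.trans (hp.2 b hb.1 hbp))
  -- `f` maps the ray of `p` to the ray of `f p`
  have hrayMap : ∀ {p a : M}, IsPrimary p → (a = 1 ∨ (IsPrimary a ∧ a ≼ p)) →
      (f a = 1 ∨ (IsPrimary (f a) ∧ f a ≼ f p)) := by
    intro p a hp ha
    rcases ha with rfl | ⟨ha, hap⟩
    · exact Or.inl h1
    · exact Or.inr ⟨(hprim a).mpr ha, (hprec ha hp).mpr hap⟩
  -- `f` maps `p`-free elements to `f p`-free elements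
  have hfreeMap : ∀ {p t : M}, IsPrimary p → (∀ z : M, IsPrimary z → z ≼ p → ¬ z ∣ t) →
      ∀ z' : N, IsPrimary z' → z' ≼ f p → ¬ z' ∣ f t := by
    intro p t hp ht z' hz' hz'p hd
    obtain ⟨z, rfl⟩ := hf.2 z'
    have hz : IsPrimary z := (hprim z).mp hz'
    exact ht z hz ((hprec hz hp).mp hz'p) ((hdvd _ _).mpr hd)
  -- it suffices to compare the primary divisors of both sides
  suffices key : ∀ q : N, IsPrimary q → (q ∣ f (x * y) ↔ q ∣ f x * f y) from
    dvd_antisymm_of_isSharp hNs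
      (hN.dvd_of_forall_isPrimary_dvd' hNp fun q hq hqd => (key q hq).mp hqd)
      (hN.dvd_of_forall_isPrimary_dvd' hNp fun q hq hqd => (key q hq).mpr hqd)
  intro q hq
  obtain ⟨p, rfl⟩ := hf.2 q
  have hp : IsPrimary p := (hprim p).mp hq
  -- split `x` and `y` at the ray of `p`
  obtain ⟨x₁, x₂, hxs, hx₁, hx₂⟩ := hM.exists_raySplit hMp x hp
  obtain ⟨y₁, y₂, hys, hy₁, hy₂⟩ := hM.exists_raySplit hMp y hp
  have hcop : ∀ {a t : M}, (a = 1 ∨ (IsPrimary a ∧ a ≼ p)) →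
      (∀ z : M, IsPrimary z → z ≼ p → ¬ z ∣ t) → ∀ z : M, z ∣ a → z ∣ t → z = 1 := by
    intro a t ha ht z hza hzt
    by_contra hz
    obtain ⟨hzprim, hzp⟩ := hM.ray_of_dvd hz ha hza
    exact ht z hzprim hzp hzt
  have hfx : f x = f x₁ * f x₂ := by
    rw [← hxs]; exact map_mul_of_forall_common_dvd_eq_one hM hN hMp hNp f hf hdvd (hcop hx₁ hx₂)
  have hfy : f y = f y₁ * f y₂ := by
    rw [← hys]; exact map_mul_of_forall_common_dvd_eq_one hM hN hMp hNp f hf hdvd (hcop hy₁ hy₂)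
  have hx₁y₁ := hM.ray_mul hp hx₁ hy₁
  have hx₂y₂ := hM.rayFree_mul hMp hp hx₂ hy₂
  -- `f p ∣ f (x y) ↔ p ∣ x₁ y₁`
  have e1 : f p ∣ f (x * y) ↔ p ∣ x₁ * y₁ := by
    rw [← hdvd, ← hxs, ← hys, mul_mul_mul_comm]
    exact ⟨fun hd => hM.dvd_of_ray_of_dvd_mul hMp hp hp (precsim_refl p) hx₁y₁ hx₂y₂ hd,
      fun hd => hd.mul_right _⟩
  -- `f p ∣ f x · f y ↔ p ∣ x₁ y₁`
  have e2 : f p ∣ f x * f y ↔ p ∣ x₁ * y₁ := by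
    rw [hfx, hfy, mul_mul_mul_comm, ← hray' hp hx₁ hy₁, hdvd p (x₁ * y₁)]
    have hfree₂ := hN.rayFree_mul hNp hq (hfreeMap hp hx₂) (hfreeMap hp hy₂)
    exact ⟨fun hd => hN.dvd_of_ray_of_dvd_mul hNp hq hq (precsim_refl _) (hrayMap hp hx₁y₁) hfree₂ hd,
      fun hd => hd.mul_right _⟩
  rw [e1, e2]

end OrderIso

end Literature.AlgebraicGeometry.Frobenioids
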